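import Summits.CriticalPhenomena.PercolationContinuityZ3.Theorems.PercNearOneGluingNoHeavyLowerTailSahiCoordinateChordPieces
import Summits.CriticalPhenomena.PercolationContinuityZ3.Theorems.SahiMasterFamilyPointwiseCoordinateGluingSettled
import Mathlib.Tactic.Linarith
import Mathlib.Tactic.Ring
import HarnessLib

/-!
# `NoHeavyLowerTail` (crux stmt-CriticalPhenomena-4575), master-family line P2: the two-thirds quantity (T3) at a coordinate IMPLIED BY TWO members —
# closed form and nonnegativity

Support file (seat `prim-masterthm-p2`, gen 11; `--supports stmt-CriticalPhenomena-4575`); no definition, no sorry.  Memo SAHI-ROUTE.md §4.34(h).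

The typed conjecture (T3∀) (`SahiCoordinateTwoThirds.TwoThirds`, p283645: `coordPiece₂(e) + E_3(0-sections) ≥ 0` at every coordinate of every increasing triple;
implies Kahn's `C_3`) is proved here at every coordinate `e` IMPLIED BY TWO members: for `A` ARBITRARY in `e` and `e`-free `B, C`,
  `coordPiece₂(e; A, B∪{e∈ω}, C∪{e∈ω}) + E_3(A⁰, B, C) = ν_A·(1 − m(B∩C)) + m(A⁰ ∩ Bᶜ ∩ Cᶜ) + Cov(A⁰, B∩C) ≥ 0`
(`twoThirds_quantity_unionCoord_two_eq`, from `SahiCoordinateChord.coordPiece₂_eq`; the bracket is the `t(1−t)` coefficient of master-conj's double disjunctive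
gluing identity (B), `Pointwise.sahiE_three_unionCoord_two_free`).  Companion of `…SahiCoordinateTwoThirdsCases` (a member REQUIRING `e`).  The SINGLY-implied case
(`A ∪ {e∈ω}` with `B, C` arbitrary) is census-true but OPEN (no local Harris certificate, memo §4.34(h)).
HONEST FRAMING: one proved case of a typed conjecture; Kahn's Conjecture 5 / Sahi's `C_3` and (T3∀) remain OPEN.  Axioms standard. [this work]
-/

noncomputable section

open scoped Classical

namespace Summit.CriticalPhenomena.PercolationContinuityZ3.Theorems

namespace SahiCoordinateTwoThirds

open Finset Function
open Literature.Combinatorics.Sahi2008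
open Literature.Probability.Percolation.DecisionTree (ind ind_of_mem ind_of_not_mem ind_nonneg)
open SahiCombDisjunct
open SahiCoordinateBernstein (coordPiece₁ coordPiece₂)

variable {ι : Type} [Fintype ι]

section DoublyImplied

variable (p : ι → unitInterval) (e : ι) (A B C : Set (Set ι)) (hBe : ∀ b : Bool, secAt e b B = B) (hCe : ∀ b : Bool, secAt e b C = C)
include hBe hCe

attribute [local simp] secAt_inter secAt_union secAt_true_coord secAt_false_coord

/-- **The (T3) quantity at a coordinate implied by two members, in closed form**:
`coordPiece₂(e; A, B∪{e∈ω}, C∪{e∈ω}) + E_3(A⁰, B, C) = ν_A·(1 − m(B∩C)) + [mA⁰ − m(A⁰∩B) − m(A⁰∩C) + m(A⁰∩B∩C)] + [m(A⁰∩B∩C) − mA⁰·m(B∩C)]`. [this work] -/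
theorem twoThirds_quantity_unionCoord_two_eq :
    coordPiece₂ p e ![A, B ∪ {ω : Set ι | e ∈ ω}, C ∪ {ω : Set ι | e ∈ ω}] +
        sahiE (bernoulliWeight p) 3 ![ind (secAt e false A), ind (secAt e false (B ∪ {ω : Set ι | e ∈ ω})),
          ind (secAt e false (C ∪ {ω : Set ι | e ∈ ω}))] =
      (ex (bernoulliWeight p) (ind (secAt e true A)) - ex (bernoulliWeight p) (ind (secAt e false A))) *
          (1 - ex (bernoulliWeight p) (ind (B ∩ C)))
      + (ex (bernoulliWeight p) (ind (secAt e false A)) - ex (bernoulliWeight p) (ind (secAt e false A ∩ B))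
          - ex (bernoulliWeight p) (ind (secAt e false A ∩ C)) + ex (bernoulliWeight p) (ind (secAt e false A ∩ B ∩ C)))
      + (ex (bernoulliWeight p) (ind (secAt e false A ∩ B ∩ C))
          - ex (bernoulliWeight p) (ind (secAt e false A)) * ex (bernoulliWeight p) (ind (B ∩ C))) := by
  have hB1 : secAt e true (B ∪ {ω : Set ι | e ∈ ω}) = Set.univ := by simp [hBe]
  have hB0 : secAt e false (B ∪ {ω : Set ι | e ∈ ω}) = B := by simp [hBe]
  have hC1 : secAt e true (C ∪ {ω : Set ι | e ∈ ω}) = Set.univ := by simp [hCe]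
  have hC0 : secAt e false (C ∪ {ω : Set ι | e ∈ ω}) = C := by simp [hCe]
  have hE : sahiE (bernoulliWeight p) 3 ![ind (secAt e false A), ind B, ind C] =
      2 * ex (bernoulliWeight p) (ind (secAt e false A ∩ B ∩ C))
      + ex (bernoulliWeight p) (ind (secAt e false A)) * ex (bernoulliWeight p) (ind B) * ex (bernoulliWeight p) (ind C)
      - (ex (bernoulliWeight p) (ind (secAt e false A)) * ex (bernoulliWeight p) (ind (B ∩ C))
        + ex (bernoulliWeight p) (ind B) * ex (bernoulliWeight p) (ind (secAt e false A ∩ C))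
        + ex (bernoulliWeight p) (ind C) * ex (bernoulliWeight p) (ind (secAt e false A ∩ B))) := by
    rw [sahiE_three]
    simp only [ind_mul_ind_eq_inter]
  rw [SahiCoordinateChord.coordPiece₂_eq, hB1, hB0, hC1, hC0, hE]
  simp only [Set.inter_univ, ex_ind_univ]
  ring

/-- **(T3) holds at every coordinate implied by two members**: for increasing `A` (arbitrary in `e`) and `e`-free increasing `B, C`,
`0 ≤ coordPiece₂(e; A, B∪{e∈ω}, C∪{e∈ω}) + E_3(0-sections)`. [this work] -/
theorem twoThirdsAt_unionCoord_two (hA : IsUpperSet A) (hB : IsUpperSet B) (hC : IsUpperSet C) :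
    0 ≤ coordPiece₂ p e ![A, B ∪ {ω : Set ι | e ∈ ω}, C ∪ {ω : Set ι | e ∈ ω}] +
        sahiE (bernoulliWeight p) 3 ![ind (secAt e false A), ind (secAt e false (B ∪ {ω : Set ι | e ∈ ω})),
          ind (secAt e false (C ∪ {ω : Set ι | e ∈ ω}))] := by
  rw [twoThirds_quantity_unionCoord_two_eq p e A B C hBe hCe]
  have nA := Pointwise.ex_secAt_true_sub_false_nonneg p e hA
  have cBC : 0 ≤ 1 - ex (bernoulliWeight p) (ind (B ∩ C)) := by rw [Pointwise.one_sub_ex_ind]; exact ex_ind_nonneg' p _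
  have cell : 0 ≤ ex (bernoulliWeight p) (ind (secAt e false A)) - ex (bernoulliWeight p) (ind (secAt e false A ∩ B))
      - ex (bernoulliWeight p) (ind (secAt e false A ∩ C)) + ex (bernoulliWeight p) (ind (secAt e false A ∩ B ∩ C)) := by
    rw [← Pointwise.ex_ind_inter_compl_compl]; exact ex_ind_nonneg' p _
  have cov : 0 ≤ ex (bernoulliWeight p) (ind (secAt e false A ∩ B ∩ C)) -
      ex (bernoulliWeight p) (ind (secAt e false A)) * ex (bernoulliWeight p) (ind (B ∩ C)) := by
    rw [Set.inter_assoc]; exact Pointwise.cov_ind_nonneg p (isUpperSet_secAt e false hA) (hB.inter hC)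
  have t1 := mul_nonneg nA cBC
  linarith

end DoublyImplied

end SahiCoordinateTwoThirds

end Summit.CriticalPhenomena.PercolationContinuityZ3.Theorems
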